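import Literature.Computability.AlgebraicComplexity.Bur24UnboundedDegreeClassesField
import Mathlib.Logic.Equiv.Fintype
import Mathlib.Order.Interval.Finset.Nat
import HarnessLib

/-!
# The `VNPnb⁰`-complete family `(D_n)` (Bürgisser 2024 survey, §4.2, (4.4); Malod 2007)

P. Bürgisser, *Completeness classes in algebraic complexity theory* (arXiv:2406.06217, 2024), §4.2,
proof outline of Thm. 4.6 (held text `paper:arxiv-2406.06217`, p0016 L41–L61), after recalling
Malod's generic computation `G_{-n} = 1, G_{-n+q} = x_q, G_m = (Σ_{i<m} a_{mi} G_i)(Σ_{j<m} b_{mj} G_j)`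
(4.3) and "(G_n) is a `VPnb⁰`-complete sequence" (both in the tree:
`MalodGenericComputation.lean`, `Bur24_sec4_2_genericComputation_VPnb0Complete`):

> We derive from this the `VNPnb⁰`-complete sequence `(D_n)` defined by
> (4.4) `D_n := Σ_{k=0}^{n} c_k Σ_{e ∈ {0,1}^{n-k}} G_n(x_1, …, x_k, e_1, …, e_{n-k})`,
> where the `c_i` are new variables.

This file defines `D_n` as printed and PROVES both halves of "`(D_n)` is `VNPnb⁰`-complete"
(`VNPnb⁰` = `IsVNPnb0Family` of `Bur24UnboundedDegreeClasses.lean`, Def. 4.4; completeness under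
p-projections with substituted constants in `{0, ±1}`, as for `(G_n)`), plus the ring-generic
companion for the classes `VNPnb^k` "allowing constants in `k` for free" (p0016 L8–L11,
`IsVNPnbFamily` of `Bur24UnboundedDegreeClassesField.lean`). Three definitions of record
(`MalodGeneric.DVar`, `MalodGeneric.boolSpec`, `MalodGeneric.malodD`), auxiliary definitions for
the proofs, the rest theorems; 0 named facts.

## Structure of the argument (the survey gives none; ours)

* §0 **Input-slot symmetry of `G_n`** (`MalodGeneric.rename_varPerm_genericComputation`): renaming
  the inputs `x_q ↦ x_{π q}` together with the coefficient variables `a_{m,q} ↦ a_{m,π q}`,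
  `b_{m,q} ↦ b_{m,π q}` (`MalodGeneric.varPerm`, `π` a permutation of the input slots) FIXES `G_n`,
  since every level (4.3) sums over all earlier values; hence `G_n(φ ∘ varPerm π) = G_n(φ)`
  (`MalodGeneric.aeval_comp_varPerm_genericComputation`).
* §1 `MalodGeneric.malodD` = (4.4), over any commutative coefficient ring `k` (explicit; `k = ℤ`
  is the printed constant-free setting), in the variables `MalodGeneric.DVar n = Var n ⊕ Fin (n+1)`
  (`Sum.inr kk = c_kk`); `MalodGeneric.boolSpec n kk e` is the substitution
  `G_n(x_1, …, x_kk, e_1, …, e_{n-kk})` (input slot `q ≤ kk` keeps `x_q`, slot `kk + 1 + j` gets `e_j`).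
* §2 **Membership** `MalodGeneric.isVNPnb0Family_malodD`: `D_n = Σ_{e ∈ {0,1}^n} S_n(X, e)`
  (`MalodGeneric.boolSum_malodDSummand`) for the summand
  `S_n = Σ_kk c_kk · G_n(x_1, …, x_kk, e_1, …, e_{n-kk}) · Π_{j ≥ n-kk} (1 - e_j)`
  (`MalodGeneric.malodDSummand`; the product restricts `{0,1}^n` to `{0,1}^{n-kk} × {0}^{kk}`,
  `MalodGeneric.sum_boolCube_extend`), and `τ(S_n) ≤ 10 (n+1)³` by the tree's `τ`-calculus
  (`constantFreeComplexity_aeval_le/_finset_sum_le/_finset_prod_le`) from `τ(G_n) ≤ n(8n+1)`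
  (`MalodGeneric.constantFreeComplexity_malodDSummand_le`, `MalodGeneric.isVPnb0Family_malodDSummand`).
* §3 **Hardness** `MalodGeneric.boolSum_eval_eq_aeval_dSpec_malodD`: for a fan-in-two circuit `P`
  over `σ ⊕ Fin u`, PART 2 of `MalodGenericComputation.lean` gives `P = G_N(spec)`,
  `N = #σ + u + 2|P| + 1` (`MalodGeneric.lvl`), with the input slots reading the variables in the
  uncontrolled order of `Fintype.equivFin`; §0 and the permutation `MalodGeneric.slotPermBool`
  (`Equiv.extendSubtype`) move the `u` Boolean variables to the LAST `u` slots, in order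
  (`MalodGeneric.specB`, `MalodGeneric.specB_inl_tail`, `MalodGeneric.specB_inl_head`); then
  `Σ_{e ∈ {0,1}^u} P(X, e) = D_N(dSpec)` where `MalodGeneric.dSpec` kills all `c_kk` but
  `c_{N-u} ↦ 1` and otherwise substitutes as `specB` (variables of `σ`, and the constants / sum
  coefficients of `P` and `0, ±1` — sign constants for constant-free `P`,
  `MalodGeneric.dSpec_isVarOrSignConst`).
* **`Bur24_sec4_2_malodD_VNPnb0Complete`** — "(D_n) is `VNPnb⁰`-complete": membership, and every
  `VNPnb⁰` family `f` satisfies `f_n = D_{t(n)}(φ_n)` with `t` p-bounded and `φ_n` substituting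
  variables and sign constants; `IsVNPnb0Family.isPProjection_malodD`.
* §4 and **`Bur24_sec4_2_malodD_VNPnbComplete`**, `IsVNPnbFamily.isPProjection_malodD` — the same
  over any commutative ring `k` with constants free (`L`-calculus: `complexity_aeval_le`, …); a
  ring-generic form of the printed statement, recorded because §3 is ring-agnostic.

Honest framing: a completeness theorem of a published survey, kernel-checked; nothing here bears
on `VP ≠ VNP` / `VPnb ≠ VNPnb`, which are NOT proved.

## References

* [Burgisser2024Completeness] P. Bürgisser, arXiv:2406.06217 (2024), §4.2, (4.3)–(4.4)
  (p0016 L41–L61), Def. 4.4 (p0015 L106–L111), p0016 L8–L11 (classes over a field).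
* G. Malod, *The complexity of polynomials and their coefficient functions*, CCC 2007
  ([malod:07] of the survey; origin of `(G_n)`, `(D_n)`); P. Bürgisser, *Completeness and Reduction
  in Algebraic Complexity Theory*, Springer 2000 ([buer:00-3]), generic computations.
-/

noncomputable section

open MvPolynomial

namespace Literature.Computability.AlgebraicComplexity

universe u v

namespace MalodGeneric

/-! ## §0. Input-slot symmetry of the generic computation `G_n`

`G_n` is symmetric in its inputs `x_1, …, x_n` up to renaming the auxiliary variables: permuting
the input slots by `π` and the coefficient variables `a_{m,q}, b_{m,q}` (`q` an input slot) along
`π` fixes `G_n` — each level (4.3) sums over ALL earlier values. -/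

section Symmetry

variable (k : Type u) [CommRing k] (n : ℕ) (π : Equiv.Perm (Fin n))

/-- The action of a permutation `π` of the input slots on the value indices of `G_n`: the
constant slot `0` (`G_{-n} = 1`) and the levels `q > n` are fixed, the input slot `1 ≤ q ≤ n`
(`x_q`) goes to `π(q-1) + 1`. [cite: Burgisser2024Completeness, §4.2 (4.3) (p0016 L42–L50)] -/
def slotPerm (q : ℕ) : ℕ :=
  if h : 1 ≤ q ∧ q ≤ n then (π ⟨q - 1, by omega⟩ : ℕ) + 1 else q

/-- The constant slot is fixed. [cite: Burgisser2024Completeness, §4.2 (4.3) (p0016 L42–L50)] -/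
theorem slotPerm_zero : slotPerm n π 0 = 0 := by
  simp [slotPerm]

/-- Levels are fixed. [cite: Burgisser2024Completeness, §4.2 (4.3) (p0016 L42–L50)] -/
theorem slotPerm_of_lt {q : ℕ} (hq : n < q) : slotPerm n π q = q := by
  rw [slotPerm, dif_neg (by omega)]

/-- Input slots are permuted. [cite: Burgisser2024Completeness, §4.2 (4.3) (p0016 L42–L50)] -/
theorem slotPerm_of_mem {q : ℕ} (h1 : 1 ≤ q) (hq : q ≤ n) :
    slotPerm n π q = (π ⟨q - 1, by omega⟩ : ℕ) + 1 := by
  rw [slotPerm, dif_pos ⟨h1, hq⟩]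

/-- Input slots stay input slots. [cite: Burgisser2024Completeness, §4.2 (4.3) (p0016 L42–L50)] -/
theorem slotPerm_mem {q : ℕ} (h1 : 1 ≤ q) (hq : q ≤ n) :
    1 ≤ slotPerm n π q ∧ slotPerm n π q ≤ n := by
  rw [slotPerm_of_mem n π h1 hq]
  have := (π ⟨q - 1, by omega⟩).isLt
  omega

/-- `slotPerm` never exceeds `max q n`. [cite: Burgisser2024Completeness, §4.2 (4.3) (p0016 L42–L50)] -/
theorem slotPerm_le (q : ℕ) : slotPerm n π q ≤ max q n := by
  by_cases h : 1 ≤ q ∧ q ≤ n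
  · exact ((slotPerm_mem n π h.1 h.2).2).trans (le_max_right _ _)
  · rw [slotPerm, dif_neg h]; exact le_max_left _ _

/-- `slotPerm` of `π⁻¹` undoes `slotPerm` of `π`. [cite: Burgisser2024Completeness, §4.2 (4.3) (p0016 L42–L50)] -/
theorem slotPerm_symm_slotPerm (q : ℕ) : slotPerm n π.symm (slotPerm n π q) = q := by
  by_cases h : 1 ≤ q ∧ q ≤ n
  · obtain ⟨h1, hq⟩ := h
    have hmem := slotPerm_mem n π h1 hq
    rw [slotPerm_of_mem n π.symm hmem.1 hmem.2]
    have hval : (⟨slotPerm n π q - 1, by omega⟩ : Fin n) = π ⟨q - 1, by omega⟩ := by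
      apply Fin.ext
      simp [slotPerm_of_mem n π h1 hq]
    rw [hval, Equiv.symm_apply_apply]
    simp only
    omega
  · have hq : slotPerm n π q = q := by rw [slotPerm, dif_neg h]
    rw [hq, slotPerm, dif_neg h]

/-- `slotPerm` as a permutation of `ℕ`. [cite: Burgisser2024Completeness, §4.2 (4.3) (p0016 L42–L50)] -/
def slotEquiv : Equiv.Perm ℕ where
  toFun := slotPerm n π
  invFun := slotPerm n π.symm
  left_inv := slotPerm_symm_slotPerm n π
  right_inv q := by simpa using slotPerm_symm_slotPerm n π.symm q

/-- The induced renaming of the variables of `G_n`: `x_q ↦ x_{π q}`, `a_{m,q} ↦ a_{m,π q}`,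
`b_{m,q} ↦ b_{m,π q}` (`π` extended to all value indices by `slotPerm`).
[cite: Burgisser2024Completeness, §4.2 (4.3) (p0016 L42–L50)] -/
def varPerm : Var n → Var n
  | .inl i => .inl (Fin.ofNat (n + 1) (slotPerm n π i))
  | .inr (m, q, s) => .inr (m, Fin.ofNat (2 * n + 1) (slotPerm n π q), s)

/-- The renaming sends the coefficient variable `a_{m,q'}` / `b_{m,q'}` (`q' ≤ 2n`) to
`a_{m, π q'}` / `b_{m, π q'}`. [cite: Burgisser2024Completeness, §4.2 (4.3) (p0016 L42–L50)] -/
theorem rename_varPerm_coef (m : ℕ) {q' : ℕ} (hq' : q' ≤ 2 * n) (s : Bool) :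
    rename (varPerm n π) (coef k n m q' s) = coef k n m (slotPerm n π q') s := by
  rw [coef, rename_X, coef, coefIdx, coefIdx]
  congr 2
  simp only [varPerm]
  congr 3
  simp [Nat.mod_eq_of_lt (Nat.lt_succ_of_le hq')]

/-- A `List.range` sum is invariant under the slot permutation of its indices once the range
covers all input slots. [folklore] -/
private theorem sum_range_slotPerm {M : Type*} [AddCommMonoid M] (F : ℕ → M) {q : ℕ} (hq : n < q) :
    ((List.range q).map fun q' => F (slotPerm n π q')).sum = ((List.range q).map F).sum := by
  rw [← List.sum_toFinset _ List.nodup_range, ← List.sum_toFinset _ List.nodup_range,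
    List.toFinset_range]
  refine Finset.sum_equiv (slotEquiv n π) (fun i => ?_) (fun i _ => rfl)
  simp only [Finset.mem_range]
  show i < q ↔ slotPerm n π i < q
  by_cases h : 1 ≤ i ∧ i ≤ n
  · have := slotPerm_mem n π h.1 h.2
    constructor <;> intro <;> omega
  · rw [slotPerm, dif_neg h]

/-- **Input-slot symmetry of the values**: renaming along `π` sends the value of index `q` to the
value of index `slotPerm π q` (`q ≤ 2n`). [cite: Burgisser2024Completeness, §4.2 (4.3) (p0016 L42–L50)] -/
theorem rename_varPerm_value :
    ∀ q, q ≤ 2 * n → rename (varPerm n π) (value k n q) = value k n (slotPerm n π q) := by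
  intro q
  induction q using Nat.strong_induction_on with
  | _ q ih =>
    intro hq
    by_cases hqn : q ≤ n
    · rw [value_input k n hqn]
      by_cases hq0 : q = 0
      · subst hq0
        rw [slotPerm_zero, value_zero]
        simp [input]
      · have hmem := slotPerm_mem n π (Nat.one_le_iff_ne_zero.2 hq0) hqn
        rw [value_input k n hmem.2, input, if_neg hq0, input, if_neg (by omega), rename_X]
        congr 1
        simp only [varPerm]
        congr 2
        simp [Nat.mod_eq_of_lt (Nat.lt_succ_of_le hqn)]
    · have hnq : n < q := not_le.1 hqn
      rw [slotPerm_of_lt n π hnq, value_level k n hnq, map_mul]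
      have key : ∀ s : Bool, MvPolynomial.rename (varPerm n π)
          (((List.range q).map fun q' => coef k n (q - n) q' s * value k n q').sum) =
          ((List.range q).map fun q' => coef k n (q - n) q' s * value k n q').sum := by
        intro s
        rw [map_list_sum, List.map_map]
        have hcongr : ((List.range q).map (MvPolynomial.rename (varPerm n π) ∘ fun q' =>
            coef k n (q - n) q' s * value k n q')) =
            (List.range q).map fun q' =>
              coef k n (q - n) (slotPerm n π q') s * value k n (slotPerm n π q') := by
          refine List.map_congr_left fun q' hq' => ?_
          have hq'q := List.mem_range.1 hq'
          rw [Function.comp_apply, map_mul, rename_varPerm_coef k n π _ (by omega),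
            ih q' hq'q (by omega)]
        rw [hcongr]
        exact sum_range_slotPerm n π (fun q' => coef k n (q - n) q' s * value k n q') hnq
      rw [key, key]

/-- **`G_n` is fixed by the renaming along any permutation of its input slots.**
[cite: Burgisser2024Completeness, §4.2 (4.3) (p0016 L42–L54)] -/
theorem rename_varPerm_genericComputation :
    rename (varPerm n π) (genericComputation k n) = genericComputation k n := by
  rw [genericComputation, rename_varPerm_value k n π _ le_rfl]
  rcases Nat.eq_zero_or_pos n with rfl | hn
  · simp [slotPerm]
  · rw [slotPerm_of_lt n π (by omega)]

/-- Hence a specialisation of `G_n` may be precomposed with the renaming: `G_n(φ ∘ varPerm π) =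
G_n(φ)`. [cite: Burgisser2024Completeness, §4.2 (4.3) (p0016 L42–L54)] -/
theorem aeval_comp_varPerm_genericComputation {A : Type v} [CommSemiring A] [Algebra k A]
    (φ : Var n → A) :
    aeval (φ ∘ varPerm n π) (genericComputation k n) = aeval φ (genericComputation k n) := by
  rw [← aeval_rename, rename_varPerm_genericComputation]

end Symmetry

/-! ## §1. The family `(D_n)` (4.4) -/

section DefD

variable (k : Type u) [CommRing k] (n : ℕ)

/-- The variables of `D_n`: those of `G_n` (`Sum.inl`: inputs `x_q` and coefficient variables
`a_{m,q}, b_{m,q}`) and the new variables `c_0, …, c_n` (`Sum.inr kk = c_kk`).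
[cite: Burgisser2024Completeness, §4.2 (4.4) (p0016 L55–L61)] -/
abbrev DVar (n : ℕ) : Type := Var n ⊕ Fin (n + 1)

/-- The substitution `G_n(x_1, …, x_kk, e_1, …, e_{n-kk})` of (4.4): the input slots `q ≤ kk` keep
their variable `x_q`, the input slot `kk + 1 + j` receives the Boolean value `e_j ∈ {0, 1}`
(`j < n - kk`), the coefficient variables are kept. [cite: Burgisser2024Completeness, §4.2 (4.4) (p0016 L57–L59)] -/
def boolSpec (kk : ℕ) (e : Fin (n - kk) → Bool) : Var n → MvPolynomial (DVar n) k
  | .inl i => if h : (i : ℕ) ≤ kk then X (Sum.inl (Sum.inl i))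
      else if e ⟨(i : ℕ) - kk - 1, by have := i.isLt; omega⟩ then 1 else 0
  | .inr t => X (Sum.inl (Sum.inr t))

/-- **Malod's family `(D_n)`, Bürgisser 2024 (4.4)**:
`D_n := Σ_{kk=0}^{n} c_kk · Σ_{e ∈ {0,1}^{n-kk}} G_n(x_1, …, x_kk, e_1, …, e_{n-kk})`, "where the `c_i`
are new variables". [cite: Burgisser2024Completeness, §4.2 (4.4) (p0016 L55–L61)] -/
def malodD : MvPolynomial (DVar n) k :=
  ∑ kk : Fin (n + 1), X (Sum.inr kk) *
    ∑ e : Fin (n - kk) → Bool, aeval (boolSpec k n kk e) (genericComputation k n)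

end DefD

/-! ## §2. Membership: `(D_n) ∈ VNPnb⁰`

`D_n` is the Boolean sum over `e ∈ {0,1}^n` of the `VPnb⁰` family
`S_n := Σ_{kk} c_kk · G_n(x_1, …, x_kk, e_1, …, e_{n-kk}) · Π_{j ≥ n-kk} (1 - e_j)` (the last product
restricts the cube `{0,1}^n` to `{0,1}^{n-kk} × {0}^{kk}`); `τ(S_n) = O(n³)` by the tree's
`τ`-calculus (`n + 1` specialisations of the size-`n(8n+1)` circuit of `G_n`). -/

section Membership

variable (k : Type u) [CommRing k] (n : ℕ)

/-- The summand's substitution: as `boolSpec`, but the slot `kk + 1 + j` receives the Boolean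
VARIABLE `e_j` (`Sum.inr j`, `j < n`). [cite: Burgisser2024Completeness, §4.2 (4.4) (p0016 L57–L59)] -/
def boolSpecVar (kk : ℕ) : Var n → MvPolynomial (DVar n ⊕ Fin n) k
  | .inl i => if h : (i : ℕ) ≤ kk then X (Sum.inl (Sum.inl (Sum.inl i)))
      else X (Sum.inr ⟨(i : ℕ) - kk - 1, by have := i.isLt; omega⟩)
  | .inr t => X (Sum.inl (Sum.inl (Sum.inr t)))

/-- The `VPnb⁰` summand `S_n = Σ_{kk} c_kk · G_n(x_1, …, x_kk, e_1, …, e_{n-kk}) · Π_{j ≥ n-kk} (1 - e_j)`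
in the variables of `D_n` and `n` Boolean variables `e_0, …, e_{n-1}`.
[cite: Burgisser2024Completeness, §4.2 (4.4) and Def. 4.4 (p0016 L55–L61, p0015 L110–L111)] -/
def malodDSummand : MvPolynomial (DVar n ⊕ Fin n) k :=
  ∑ kk : Fin (n + 1), X (Sum.inl (Sum.inr kk)) *
    aeval (boolSpecVar k n kk) (genericComputation k n) *
      ∏ j ∈ (Finset.univ : Finset (Fin n)).filter (fun j : Fin n => n - kk ≤ j.val), (1 - X (Sum.inr j))

/-- Plugging Boolean values into the summand's substitution gives the substitution of (4.4) at
the restricted Boolean vector. [cite: Burgisser2024Completeness, §4.2 (4.4) (p0016 L57–L59)] -/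
theorem aeval_boolSpecVar (e : Fin n → Bool) (kk : ℕ) (v : Var n) :
    aeval (Sum.elim X fun j => if e j then (1 : MvPolynomial (DVar n) k) else 0)
        (boolSpecVar k n kk v) =
      boolSpec k n kk (fun j => e (Fin.castLE (Nat.sub_le n kk) j)) v := by
  rcases v with i | t
  · by_cases h : (i : ℕ) ≤ kk
    · simp [boolSpecVar, boolSpec, h]
    · simp [boolSpecVar, boolSpec, h]
  · simp [boolSpecVar, boolSpec]

/-- `Π_{j ∈ s} (1 - e_j) = [e_j = 0 for all j ∈ s]` on Boolean values. [folklore] -/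
private theorem prod_one_sub_boole {R : Type*} [CommRing R] (e : Fin n → Bool) (s : Finset (Fin n)) :
    ∏ j ∈ s, (1 - (if e j then (1 : R) else 0)) = if ∀ j ∈ s, e j = false then 1 else 0 := by
  by_cases hall : ∀ j ∈ s, e j = false
  · rw [if_pos hall]
    exact Finset.prod_eq_one fun j hj => by simp [hall j hj]
  · rw [if_neg hall]
    push Not at hall
    obtain ⟨j, hj, hej⟩ := hall
    have hej' : e j = true := by cases h : e j <;> simp_all
    exact Finset.prod_eq_zero hj (by simp [hej'])

/-- **Extension by zeros**: summing `F` of the first `m` coordinates over the Boolean vectors of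
length `n ≥ m` that vanish beyond `m` is summing `F` over `{0,1}^m`. [folklore] -/
private theorem sum_boolCube_extend {M : Type*} [AddCommMonoid M] {m n : ℕ} (hmn : m ≤ n)
    (F : (Fin m → Bool) → M) :
    ∑ e : Fin n → Bool, (if ∀ j : Fin n, m ≤ j.val → e j = false then
        F (fun j => e (Fin.castLE hmn j)) else 0) = ∑ e' : Fin m → Bool, F e' := by
  classical
  rw [← Finset.sum_filter]
  set ext : (Fin m → Bool) → (Fin n → Bool) := fun e' j =>
    if h : (j : ℕ) < m then e' ⟨j, h⟩ else false with hext
  have hres : ∀ e' : Fin m → Bool, (fun j => ext e' (Fin.castLE hmn j)) = e' := by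
    intro e'
    funext j
    simp [hext, j.isLt]
  have hinj : Function.Injective ext := by
    intro e₁ e₂ h
    rw [← hres e₁, ← hres e₂, h]
  have hset : (Finset.univ.filter fun e : Fin n → Bool => ∀ j : Fin n, m ≤ j.val → e j = false) =
      Finset.univ.image ext := by
    ext e
    simp only [Finset.mem_filter, Finset.mem_univ, true_and, Finset.mem_image]
    constructor
    · intro h
      refine ⟨fun j => e (Fin.castLE hmn j), funext fun j => ?_⟩
      by_cases hj : (j : ℕ) < m
      · simp [hext, hj]
      · simp [hext, hj, h j (not_lt.1 hj)]
    · rintro ⟨e', rfl⟩ j hj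
      simp [hext, not_lt.2 hj]
  rw [hset, Finset.sum_image fun e₁ _ e₂ _ h => hinj h]
  exact Finset.sum_congr rfl fun e' _ => by rw [hres]

/-- The Boolean specialisation `e` of the summand, term by term. [cite: Burgisser2024Completeness, §4.2 (4.4) (p0016 L55–L61)] -/
theorem aeval_bool_malodDSummand (e : Fin n → Bool) :
    aeval (Sum.elim X fun j => if e j then (1 : MvPolynomial (DVar n) k) else 0)
        (malodDSummand k n) =
      ∑ kk : Fin (n + 1), X (Sum.inr kk) *
        (if ∀ j : Fin n, n - kk ≤ j.val → e j = false then
          aeval (boolSpec k n kk fun j => e (Fin.castLE (Nat.sub_le n kk) j))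
            (genericComputation k n) else 0) := by
  simp only [malodDSummand, map_sum, map_mul, map_prod, map_sub, map_one, aeval_X,
    Sum.elim_inl, Sum.elim_inr, comp_aeval_apply]
  refine Finset.sum_congr rfl fun kk _ => ?_
  rw [prod_one_sub_boole, show (fun v => aeval (Sum.elim X fun j =>
      if e j then (1 : MvPolynomial (DVar n) k) else 0) (boolSpecVar k n kk v)) =
      boolSpec k n kk fun j => e (Fin.castLE (Nat.sub_le n kk) j) from
    funext (aeval_boolSpecVar k n e kk)]
  simp only [Finset.mem_filter, Finset.mem_univ, true_and]
  split_ifs <;> simp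

/-- **`D_n = Σ_{e ∈ {0,1}^n} S_n(X, e)`**: `(D_n)` is the Boolean sum of its summand family.
[cite: Burgisser2024Completeness, §4.2 (4.4) and Def. 4.4 (p0016 L55–L61, p0015 L110–L111)] -/
theorem boolSum_malodDSummand : boolSum (malodDSummand k n) = malodD k n := by
  rw [boolSum, malodD]
  simp_rw [aeval_bool_malodDSummand]
  rw [Finset.sum_comm]
  refine Finset.sum_congr rfl fun kk _ => ?_
  rw [← Finset.mul_sum]
  congr 1
  exact sum_boolCube_extend (Nat.sub_le n kk)
    (fun e' => aeval (boolSpec k n kk e') (genericComputation k n))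

/-- The summand's substitution uses variables only (cost `0`). [cite: Burgisser2024Completeness, §4.2 (4.4) (p0016 L57–L59)] -/
theorem constantFreeComplexity_boolSpecVar (kk : ℕ) (v : Var n) :
    constantFreeComplexity (boolSpecVar ℤ n kk v) = 0 := by
  rcases v with i | t
  · by_cases h : (i : ℕ) ≤ kk
    · simp [boolSpecVar, h]
    · simp [boolSpecVar, h]
  · simp [boolSpecVar]

/-- `τ(G_n) ≤ n (8n + 1)` (the circuit of PART 1 of `MalodGenericComputation.lean`).
[cite: Burgisser2024Completeness, §4.2 (p0016 L53)] -/
theorem constantFreeComplexity_genericComputation_le :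
    constantFreeComplexity (genericComputation ℤ n) ≤ n * (8 * n + 1) := by
  rw [← circuit_size ℤ n]
  exact ArithCircuit.constantFreeComplexity_le_size (circuit_isFanInTwo ℤ n)
    (circuit_hasSignConstants ℤ n) (circuit_computes ℤ n)

/-- **`τ(S_n) ≤ 10 (n+1)³`**: `n + 1` terms, each a product of a variable, a specialisation of
`G_n` by variables (`τ ≤ n(8n+1)`, substitution bound) and at most `n` factors `1 - e_j`
(`τ ≤ 2` each). [cite: Burgisser2024Completeness, §4.2 (4.4) (p0016 L53–L61)] -/
theorem constantFreeComplexity_malodDSummand_le :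
    constantFreeComplexity (malodDSummand ℤ n) ≤ 10 * (n + 1) ^ 3 := by
  classical
  have hterm : ∀ kk : Fin (n + 1), constantFreeComplexity (X (Sum.inl (Sum.inr kk)) *
      aeval (boolSpecVar ℤ n kk) (genericComputation ℤ n) *
        ∏ j ∈ (Finset.univ : Finset (Fin n)).filter (fun j : Fin n => n - kk ≤ j.val),
          (1 - X (Sum.inr j)) : MvPolynomial (DVar n ⊕ Fin n) ℤ) ≤ 9 * (n + 1) ^ 2 := by
    intro kk
    have hA : constantFreeComplexity (aeval (boolSpecVar ℤ n kk) (genericComputation ℤ n)) ≤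
        n * (8 * n + 1) := by
      refine (constantFreeComplexity_aeval_le _ _).trans ?_
      simp only [constantFreeComplexity_boolSpecVar, Finset.sum_const_zero, add_zero]
      exact constantFreeComplexity_genericComputation_le n
    have hP : constantFreeComplexity (∏ j ∈ (Finset.univ : Finset (Fin n)).filter
        (fun j : Fin n => n - kk ≤ j.val), (1 - X (Sum.inr j)) : MvPolynomial (DVar n ⊕ Fin n) ℤ) ≤
        3 * n := by
      refine (constantFreeComplexity_finset_prod_le _ _).trans ?_
      have hfac : ∀ j : Fin n, constantFreeComplexity
          ((1 : MvPolynomial (DVar n ⊕ Fin n) ℤ) - X (Sum.inr j)) ≤ 2 := fun j =>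
        (constantFreeComplexity_sub_le _ _).trans (by simp)
      have hcard : ((Finset.univ : Finset (Fin n)).filter (fun j : Fin n => n - kk ≤ j.val)).card ≤ n :=
        (Finset.card_filter_le _ _).trans (by simp)
      calc _ ≤ ∑ _j ∈ (Finset.univ : Finset (Fin n)).filter (fun j : Fin n => n - kk ≤ j.val), 2 +
            ((Finset.univ : Finset (Fin n)).filter (fun j : Fin n => n - kk ≤ j.val)).card :=
            Nat.add_le_add_right (Finset.sum_le_sum fun j _ => hfac j) _
        _ ≤ 3 * n := by rw [Finset.sum_const, smul_eq_mul]; omega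
    calc _ ≤ constantFreeComplexity (X (Sum.inl (Sum.inr kk)) *
          aeval (boolSpecVar ℤ n kk) (genericComputation ℤ n) : MvPolynomial (DVar n ⊕ Fin n) ℤ) +
          constantFreeComplexity (∏ j ∈ (Finset.univ : Finset (Fin n)).filter
            (fun j : Fin n => n - kk ≤ j.val), (1 - X (Sum.inr j)) : MvPolynomial (DVar n ⊕ Fin n) ℤ) + 1 :=
          constantFreeComplexity_mul_le _ _
      _ ≤ (0 + n * (8 * n + 1) + 1) + 3 * n + 1 := by
          gcongr
          · exact (constantFreeComplexity_mul_le _ _).trans (by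
              rw [constantFreeComplexity_X]; exact Nat.add_le_add_right (Nat.add_le_add_left hA _) _)
      _ ≤ 9 * (n + 1) ^ 2 := by nlinarith
  calc constantFreeComplexity (malodDSummand ℤ n)
      ≤ ∑ kk : Fin (n + 1), constantFreeComplexity (X (Sum.inl (Sum.inr kk)) *
          aeval (boolSpecVar ℤ n kk) (genericComputation ℤ n) *
            ∏ j ∈ (Finset.univ : Finset (Fin n)).filter (fun j : Fin n => n - kk ≤ j.val),
              (1 - X (Sum.inr j)) : MvPolynomial (DVar n ⊕ Fin n) ℤ) +
          (Finset.univ : Finset (Fin (n + 1))).card := constantFreeComplexity_finset_sum_le _ _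
    _ ≤ ∑ _kk : Fin (n + 1), 9 * (n + 1) ^ 2 + (Finset.univ : Finset (Fin (n + 1))).card :=
          Nat.add_le_add_right (Finset.sum_le_sum fun kk _ => hterm kk) _
    _ = (n + 1) * (9 * (n + 1) ^ 2) + (n + 1) := by simp
    _ ≤ 10 * (n + 1) ^ 3 := by nlinarith

/-- **The summand family is in `VPnb⁰`** (p-bounded number of variables, `τ(S_n) ≤ 10 (n+1)³`).
[cite: Burgisser2024Completeness, §4.2 (4.4) and Def. 4.4 (p0016 L53–L61, p0015 L106–L109)] -/
theorem isVPnb0Family_malodDSummand : IsVPnb0Family fun n => malodDSummand ℤ n := by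
  have hsucc : IsPBounded fun n => n + 1 := IsPBounded.add_holds IsPBounded.id (IsPBounded.const 1)
  refine (isVPnb0Family_iff_isPBounded_constantFreeComplexity _).2
    ⟨(IsPBounded.mul_holds (IsPBounded.const 15) (IsPBounded.pow_holds hsucc 2)).mono fun n => ?_,
      (IsPBounded.mul_holds (IsPBounded.const 10) (IsPBounded.pow_holds hsucc 3)).mono
        (constantFreeComplexity_malodDSummand_le)⟩
  simp only [DVar, Var, Fintype.card_sum, Fintype.card_prod, Fintype.card_fin, Fintype.card_bool]
  nlinarith

/-- **`(D_n) ∈ VNPnb⁰`** (Boolean sum of length `n` of the `VPnb⁰` summand family).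
[cite: Burgisser2024Completeness, §4.2 (4.4) (p0016 L55–L61)] -/
theorem isVNPnb0Family_malodD : IsVNPnb0Family fun n => malodD ℤ n :=
  ⟨fun n => n, fun n => malodDSummand ℤ n, isVPnb0Family_malodDSummand,
    fun n => (boolSum_malodDSummand ℤ n).symm⟩

end Membership

/-! ## §3. Hardness: every Boolean sum of a fan-in-two circuit is a specialisation of `D_N`

Given a fan-in-two circuit `P` over the variables `σ ⊕ Fin u` (the last `u` Boolean), PART 2 of
`MalodGenericComputation.lean` writes `P = G_N(spec)` with `N = #(σ ⊕ Fin u) + 2|P| + 1`, the input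
slot `1 + e(y)` of `G_N` reading the variable `y` (`e = Fintype.equivFin (σ ⊕ Fin u)`). By the
symmetry of §0 we may permute the input slots so that the LAST `u` slots read the Boolean
variables `Sum.inr 0, …, Sum.inr (u-1)` in order (`slotPermBool`, built with
`Equiv.extendSubtype`); then in (4.4) only the term `kk = N - u` is needed (`c_{N-u} ↦ 1`, the other
`c_kk ↦ 0`), and it is exactly `Σ_{e ∈ {0,1}^u} P(X, e)`. -/

section Hardness

variable {k : Type u} [CommRing k] {σ : Type v} [Fintype σ] (u : ℕ) (P : ArithCircuit k (σ ⊕ Fin u))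

/-- The number of non-Boolean input slots used for `P`: `#σ + 2|P| + 1` (the `kk` of (4.4)).
[cite: Burgisser2024Completeness, §4.2 (4.4) (p0016 L52–L61)] -/
def base : ℕ := Fintype.card σ + 2 * P.size + 1

/-- The index `N = base + u = #(σ ⊕ Fin u) + 2|P| + 1` of the `D_N` specialising to `Σ_e P(X, e)`.
[cite: Burgisser2024Completeness, §4.2 (4.4) (p0016 L52–L61)] -/
def lvl : ℕ := base u P + u

omit [CommRing k] in
/-- `#(σ ⊕ Fin u) = #σ + u`. [folklore] -/
private theorem card_sum_fin : Fintype.card (σ ⊕ Fin u) = Fintype.card σ + u := by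
  simp

omit [CommRing k] in
/-- `N` is the index of PART 2 of `MalodGenericComputation.lean` for the variables `σ ⊕ Fin u`.
[cite: Burgisser2024Completeness, §4.2 (p0016 L52–L54)] -/
theorem lvl_eq : lvl u P = Fintype.card (σ ⊕ Fin u) + 2 * P.size + 1 := by
  rw [lvl, base, card_sum_fin]
  ring

/-- The input slot (0-based) of `G_N` that reads the Boolean variable `e_j` under the
specialisation `MalodGeneric.spec`. [cite: Burgisser2024Completeness, §4.2 (4.4) (p0016 L52–L61)] -/
def boolSlot (j : Fin u) : Fin (lvl u P) :=
  ⟨Fintype.equivFin (σ ⊕ Fin u) (Sum.inr j), by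
    have h := (Fintype.equivFin (σ ⊕ Fin u) (Sum.inr j)).isLt
    have hc := card_sum_fin (σ := σ) u
    rw [lvl, base]
    omega⟩

omit [CommRing k] in
/-- Distinct Boolean variables are read by distinct slots. [cite: Burgisser2024Completeness, §4.2 (4.4) (p0016 L52–L61)] -/
theorem boolSlot_injective : Function.Injective (boolSlot u P) := by
  intro j j' h
  have h' : Fintype.equivFin (σ ⊕ Fin u) (Sum.inr j) = Fintype.equivFin (σ ⊕ Fin u) (Sum.inr j') :=
    Fin.ext (by simpa [boolSlot] using congrArg Fin.val h)
  simpa using (Fintype.equivFin (σ ⊕ Fin u)).injective h'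

/-- The last `u` slots `base, …, base + u - 1` (0-based), numbered. [cite: Burgisser2024Completeness, §4.2 (4.4) (p0016 L55–L61)] -/
def tailFin : {x : Fin (lvl u P) // base u P ≤ x.val} ≃ Fin u where
  toFun x := ⟨x.1.val - base u P, by
    have h1 := x.1.isLt
    have h2 := x.2
    simp only [lvl] at h1
    omega⟩
  invFun j := ⟨⟨base u P + j, by rw [lvl]; omega⟩, Nat.le_add_right _ _⟩
  left_inv x := by
    apply Subtype.ext
    apply Fin.ext
    simp only
    have := x.2
    omega
  right_inv j := by
    apply Fin.ext
    simp

/-- The Boolean slots, numbered. [cite: Burgisser2024Completeness, §4.2 (4.4) (p0016 L55–L61)] -/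
def boolRange : Fin u ≃ {x : Fin (lvl u P) // ∃ j, boolSlot u P j = x} :=
  (Equiv.ofInjective _ (boolSlot_injective u P)).trans
    (Equiv.subtypeEquivRight fun _ => Set.mem_range)

/-- **The slot permutation** sending the last `u` slots onto the Boolean slots, in order
(`Equiv.extendSubtype`; arbitrary elsewhere). [cite: Burgisser2024Completeness, §4.2 (4.4) (p0016 L55–L61)] -/
def slotPermBool : Equiv.Perm (Fin (lvl u P)) :=
  ((tailFin u P).trans (boolRange u P)).extendSubtype

omit [CommRing k] in
/-- The permutation sends the slot `base + j` to the slot of `e_j`. [cite: Burgisser2024Completeness, §4.2 (4.4) (p0016 L55–L61)] -/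
theorem slotPermBool_tail (j : Fin u) (h : base u P + j < lvl u P) :
    slotPermBool u P ⟨base u P + j, h⟩ = boolSlot u P j := by
  have hx : base u P ≤ (⟨base u P + j, h⟩ : Fin (lvl u P)).val := Nat.le_add_right _ _
  rw [slotPermBool, Equiv.extendSubtype_apply_of_mem ((tailFin u P).trans (boolRange u P)) _ hx]
  have ht : tailFin u P ⟨⟨base u P + j, h⟩, hx⟩ = j := Fin.ext (by simp [tailFin])
  simp [boolRange, ht]

omit [CommRing k] in
/-- The permutation sends the slots below `base` to non-Boolean slots. [cite: Burgisser2024Completeness, §4.2 (4.4) (p0016 L55–L61)] -/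
theorem slotPermBool_head (x : Fin (lvl u P)) (hx : x.val < base u P) (j : Fin u) :
    slotPermBool u P x ≠ boolSlot u P j := by
  intro h
  exact Equiv.extendSubtype_not_mem ((tailFin u P).trans (boolRange u P)) x (not_le.2 hx)
    ⟨j, h.symm⟩

/-- **The specialisation with the Boolean slots last**: `MalodGeneric.spec` precomposed with the
renaming along `slotPermBool`. [cite: Burgisser2024Completeness, §4.2 (4.4) (p0016 L52–L61)] -/
def specB : Var (lvl u P) → MvPolynomial (σ ⊕ Fin u) k :=
  spec (lvl u P) P ∘ varPerm (lvl u P) (slotPermBool u P)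

/-- `P = G_N(specB)` for a fan-in-two `P` (PART 2 + §0). [cite: Burgisser2024Completeness, §4.2 (p0016 L52–L54)] -/
theorem eval_eq_aeval_specB (h2 : P.IsFanInTwo) :
    P.eval = aeval (specB u P) (genericComputation k (lvl u P)) := by
  have hN := lvl_eq u P
  have h1 : 2 * P.size + 1 ≤ lvl u P := by rw [lvl, base]; omega
  rw [specB, aeval_comp_varPerm_genericComputation, genericComputation,
    aeval_spec_value h2 hN _ le_rfl, expect, if_neg (by omega), if_neg (by omega)]

/-- The specialisation uses variables and constants; … [cite: Burgisser2024Completeness, §4.2 (p0016 L8–L11, L52–L54)] -/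
theorem specB_isVarOrConst (w : Var (lvl u P)) :
    (∃ y, specB u P w = X y) ∨ ∃ c : k, specB u P w = C c :=
  spec_isVarOrConst _

/-- … sign constants when `P` is constant-free. [cite: Burgisser2024Completeness, §4.2 (p0016 L52–L54)] -/
theorem specB_isVarOrSignConst (hsc : P.HasSignConstants) (w : Var (lvl u P)) :
    (∃ y, specB u P w = X y) ∨ ∃ c : k, ArithCircuit.IsSignConstant c ∧ specB u P w = C c :=
  spec_isVarOrSignConst hsc _

/-- Coefficient variables receive constants. [cite: Burgisser2024Completeness, §4.2 (p0016 L52–L54)] -/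
theorem specB_inr (t : Fin (lvl u P + 1) × Fin (2 * lvl u P + 1) × Bool) :
    ∃ c : k, specB u P (Sum.inr t) = C c := by
  rcases t with ⟨m, q, _ | _⟩ <;> exact ⟨_, rfl⟩

/-- The unused slot `0` receives `0`. [cite: Burgisser2024Completeness, §4.2 (p0016 L52–L54)] -/
theorem specB_inl_zero : specB u P (Sum.inl 0) = 0 := by
  simp [specB, varPerm, slotPerm_zero, spec]

/-- An input slot `q ≥ 1` reads, after the permutation, the variable numbered by the permuted slot
(or `0` if that slot is beyond the variables). [cite: Burgisser2024Completeness, §4.2 (p0016 L52–L54)] -/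
theorem specB_inl (q : ℕ) (h1 : 1 ≤ q) (hq : q ≤ lvl u P) :
    specB u P (Sum.inl ⟨q, Nat.lt_succ_of_le hq⟩) =
      if h : ((slotPermBool u P ⟨q - 1, by omega⟩ : Fin (lvl u P)) : ℕ) <
          Fintype.card (σ ⊕ Fin u) then
        X ((Fintype.equivFin (σ ⊕ Fin u)).symm ⟨_, h⟩) else 0 := by
  have hsp : slotPerm (lvl u P) (slotPermBool u P) q =
      ((slotPermBool u P ⟨q - 1, by omega⟩ : Fin (lvl u P)) : ℕ) + 1 := slotPerm_of_mem _ _ h1 hq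
  have hlt := (slotPermBool u P ⟨q - 1, by omega⟩).isLt
  have hof : (Fin.ofNat (lvl u P + 1) (slotPerm (lvl u P) (slotPermBool u P) q) : Fin (lvl u P + 1)) =
      ⟨((slotPermBool u P ⟨q - 1, by omega⟩ : Fin (lvl u P)) : ℕ) + 1, by omega⟩ := by
    apply Fin.ext
    simp only [Fin.val_ofNat, hsp]
    exact Nat.mod_eq_of_lt (by omega)
  simp only [specB, Function.comp_apply, varPerm]
  rw [hof, spec]
  simp only [Nat.add_sub_cancel, le_add_iff_nonneg_left, zero_le, true_and]
  by_cases h : ((slotPermBool u P ⟨q - 1, by omega⟩ : Fin (lvl u P)) : ℕ) < Fintype.card (σ ⊕ Fin u)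
  · rw [dif_pos (by omega), dif_pos h]
  · rw [dif_neg (by omega), dif_neg h]

/-- **The last `u` input slots read the Boolean variables, in order**: slot `base + 1 + j` reads
`e_j`. [cite: Burgisser2024Completeness, §4.2 (4.4) (p0016 L55–L61)] -/
theorem specB_inl_tail (j : Fin u) (h : base u P + 1 + j < lvl u P + 1) :
    specB u P (Sum.inl ⟨base u P + 1 + j, h⟩) = X (Sum.inr j) := by
  have hq : base u P + 1 + j ≤ lvl u P := by omega
  rw [specB_inl u P _ (by omega) hq]
  have hπ : slotPermBool u P ⟨base u P + 1 + j - 1, by omega⟩ = boolSlot u P j := by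
    rw [← slotPermBool_tail u P j (by omega)]
    congr 1
    apply Fin.ext
    simp only
    omega
  have hval : ((slotPermBool u P ⟨base u P + 1 + j - 1, by omega⟩ : Fin (lvl u P)) : ℕ) =
      Fintype.equivFin (σ ⊕ Fin u) (Sum.inr j) := by
    rw [hπ]; rfl
  have hlt : (Fintype.equivFin (σ ⊕ Fin u) (Sum.inr j) : ℕ) < Fintype.card (σ ⊕ Fin u) :=
    (Fintype.equivFin (σ ⊕ Fin u) (Sum.inr j)).isLt
  rw [dif_pos (by rw [hval]; exact hlt)]
  congr 1
  rw [Equiv.symm_apply_eq]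
  exact Fin.ext hval

/-- **The first `base` input slots read `σ`-variables or `0`** (never a Boolean variable).
[cite: Burgisser2024Completeness, §4.2 (4.4) (p0016 L55–L61)] -/
theorem specB_inl_head (i : Fin (lvl u P + 1)) (h1 : 1 ≤ i.val) (hi : i.val ≤ base u P) :
    specB u P (Sum.inl i) = 0 ∨ ∃ x : σ, specB u P (Sum.inl i) = X (Sum.inl x) := by
  have hq : i.val ≤ lvl u P := by have := i.isLt; omega
  obtain ⟨q, hq'⟩ := i
  simp only at h1 hi hq
  rw [specB_inl u P q h1 hq]
  by_cases h : ((slotPermBool u P ⟨q - 1, by omega⟩ : Fin (lvl u P)) : ℕ) < Fintype.card (σ ⊕ Fin u)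
  · rw [dif_pos h]
    right
    rcases hy : (Fintype.equivFin (σ ⊕ Fin u)).symm ⟨_, h⟩ with x | j
    · exact ⟨x, rfl⟩
    · exfalso
      refine slotPermBool_head u P ⟨q - 1, by omega⟩ (by simp only; omega) j (Fin.ext ?_)
      rw [Equiv.symm_apply_eq] at hy
      simpa [boolSlot] using congrArg Fin.val hy
  · rw [dif_neg h]
    exact Or.inl rfl

/-- **The specialisation of the variables of `D_N`**: the variables of `G_N` as under `specB` with
the Boolean variables killed (they only occur in the slots bound by the Boolean sum of the term
`kk = base`), `c_base ↦ 1`, the other `c_kk ↦ 0`. [cite: Burgisser2024Completeness, §4.2 (4.4) (p0016 L55–L61)] -/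
def dSpec : DVar (lvl u P) → MvPolynomial σ k
  | .inl w => aeval (Sum.elim X fun _ : Fin u => (0 : MvPolynomial σ k)) (specB u P w)
  | .inr kk => if (kk : ℕ) = base u P then 1 else 0

/-- `dSpec` uses variables and constants; … [cite: Burgisser2024Completeness, §4.2 (p0016 L8–L11, L55–L61)] -/
theorem dSpec_isVarOrConst (i : DVar (lvl u P)) :
    (∃ x, dSpec u P i = X x) ∨ ∃ c : k, dSpec u P i = C c := by
  rcases i with w | kk
  · simp only [dSpec]
    rcases specB_isVarOrConst u P w with ⟨y, hy⟩ | ⟨c, hc⟩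
    · rw [hy, aeval_X]
      rcases y with x | j
      · exact Or.inl ⟨x, rfl⟩
      · exact Or.inr ⟨0, by simp⟩
    · rw [hc, aeval_C, algebraMap_eq]
      exact Or.inr ⟨c, rfl⟩
  · simp only [dSpec]
    split_ifs
    · exact Or.inr ⟨1, by simp⟩
    · exact Or.inr ⟨0, by simp⟩

/-- … sign constants when `P` is constant-free. [cite: Burgisser2024Completeness, §4.2 (p0016 L55–L61)] -/
theorem dSpec_isVarOrSignConst (hsc : P.HasSignConstants) (i : DVar (lvl u P)) :
    (∃ x, dSpec u P i = X x) ∨ ∃ c : k, ArithCircuit.IsSignConstant c ∧ dSpec u P i = C c := by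
  rcases i with w | kk
  · simp only [dSpec]
    rcases specB_isVarOrSignConst u P hsc w with ⟨y, hy⟩ | ⟨c, hsgn, hc⟩
    · rw [hy, aeval_X]
      rcases y with x | j
      · exact Or.inl ⟨x, rfl⟩
      · exact Or.inr ⟨0, Or.inl rfl, by simp⟩
    · rw [hc, aeval_C, algebraMap_eq]
      exact Or.inr ⟨c, hsgn, rfl⟩
  · simp only [dSpec]
    split_ifs
    · exact Or.inr ⟨1, Or.inr (Or.inl rfl), by simp⟩
    · exact Or.inr ⟨0, Or.inl rfl, by simp⟩

/-- **The two specialisations agree slot by slot**: plugging the Boolean vector `e` into `specB`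
is `dSpec` after the substitution `boolSpec N base e` of (4.4).
[cite: Burgisser2024Completeness, §4.2 (4.4) (p0016 L55–L61)] -/
theorem aeval_bool_specB (e : Fin u → Bool) (w : Var (lvl u P)) :
    aeval (Sum.elim X fun j => if e j then (1 : MvPolynomial σ k) else 0) (specB u P w) =
      aeval (dSpec u P) (boolSpec k (lvl u P) (base u P)
        (fun j' => e ⟨j'.val, by have := j'.isLt; simp only [lvl] at this; omega⟩) w) := by
  rcases w with i | t
  · by_cases hi : (i : ℕ) ≤ base u P
    · simp only [boolSpec, dif_pos hi, aeval_X, dSpec]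
      rcases Nat.eq_zero_or_pos i.val with h0 | hpos
      · have : i = 0 := Fin.ext h0
        subst this
        simp [specB_inl_zero]
      · rcases specB_inl_head u P i hpos hi with h | ⟨x, h⟩
        · simp [h]
        · simp [h]
    · have hlt : base u P < i.val := not_le.1 hi
      have hl : lvl u P = base u P + u := rfl
      obtain ⟨q, hq'⟩ := i
      simp only at hi hlt hq'
      obtain ⟨j, hj⟩ : ∃ j : Fin u, q = base u P + 1 + j.val :=
        ⟨⟨q - base u P - 1, by omega⟩, by simp only; omega⟩
      subst hj
      simp only [boolSpec, dif_neg hi]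
      rw [specB_inl_tail u P j]
      have hj : (⟨base u P + 1 + j.val - base u P - 1, by have := j.isLt; omega⟩ : Fin u) = j :=
        Fin.ext (by simp only; omega)
      simp only [aeval_X, Sum.elim_inr, hj]
      split_ifs <;> simp
  · obtain ⟨c, hc⟩ := specB_inr u P t
    simp only [boolSpec, aeval_X, dSpec, hc, aeval_C, algebraMap_eq]

/-- **`Σ_{e ∈ {0,1}^u} P(X, e) = D_N(dSpec)`** for every fan-in-two circuit `P` over `σ ⊕ Fin u`,
`N = #σ + u + 2|P| + 1`. [cite: Burgisser2024Completeness, §4.2 (4.4) (p0016 L55–L61)] -/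
theorem boolSum_eval_eq_aeval_dSpec_malodD (h2 : P.IsFanInTwo) :
    boolSum P.eval = aeval (dSpec u P) (malodD k (lvl u P)) := by
  classical
  have hbase : base u P < lvl u P + 1 := by rw [lvl]; omega
  rw [malodD, map_sum, Finset.sum_eq_single (⟨base u P, hbase⟩ : Fin (lvl u P + 1))
    (fun kk _ hkk => by
      rw [map_mul, aeval_X, dSpec, if_neg (fun h => hkk (Fin.ext h)), zero_mul])
    (fun h => absurd (Finset.mem_univ _) h)]
  rw [map_mul, aeval_X, dSpec, if_pos rfl, one_mul, map_sum, eval_eq_aeval_specB u P h2, boolSum]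
  simp only [comp_aeval_apply]
  have hu : lvl u P - base u P = u := by rw [lvl]; exact Nat.add_sub_cancel_left _ _
  refine Fintype.sum_equiv ((finCongr hu.symm).arrowCongr (Equiv.refl Bool)) _ _ fun e => ?_
  have hε : ((finCongr hu.symm).arrowCongr (Equiv.refl Bool)) e =
      fun j' => e ⟨j'.val, by have := j'.isLt; simp only [lvl] at this; omega⟩ := by
    funext j'
    simp [Fin.cast]
  rw [hε]
  exact congrArg (fun F => aeval F (genericComputation k (lvl u P))) (funext (aeval_bool_specB u P e))

end Hardness

/-! ## §4. Constants of a ring `k` for free: `(D_n)` and the classes `VNPnb^k`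

Over a field (any commutative ring) `k` "allowing circuits using constants in `k` for free"
(p0016 L8–L11; classes `IsVPnbFamily` / `IsVNPnbFamily` of `Bur24UnboundedDegreeClassesField.lean`)
the same two arguments give: `(D_n) ∈ VNPnb^k` (the `L`-calculus in place of the `τ`-calculus) and
every `VNPnb^k` family is `D_{t(n)}` with variables and constants of `k` substituted — the `VNPnb`
companion of `Bur24_sec4_2_genericComputation_VPnbComplete`. (A generalisation of the printed
`k = ℤ` statement, recorded because §3 is ring-agnostic.) -/

section AnyRing

variable (k : Type u) [CommRing k] (n : ℕ)

/-- The summand's substitution costs nothing in `L` either. [cite: Burgisser2024Completeness, §4.2 (4.4) (p0016 L57–L59)] -/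
theorem complexity_boolSpecVar (kk : ℕ) (v : Var n) : complexity (boolSpecVar k n kk v) = 0 := by
  rcases v with i | t
  · by_cases h : (i : ℕ) ≤ kk
    · simp only [boolSpecVar, dif_pos h]; exact complexity_X_holds (k := k) _
    · simp only [boolSpecVar, dif_neg h]; exact complexity_X_holds (k := k) _
  · simp only [boolSpecVar]; exact complexity_X_holds (k := k) _

/-- `L(1 - e_j) ≤ 2` (`1 - X = 1 + (-1) • X`). [folklore] -/
private theorem complexity_one_sub_X_le {ρ : Type*} (j : ρ) :
    complexity ((1 : MvPolynomial ρ k) - X j) ≤ 2 := by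
  have h : (1 : MvPolynomial ρ k) - X j = C 1 + (-1 : k) • X j := by
    rw [C_1, neg_one_smul, sub_eq_add_neg]
  rw [h]
  calc complexity (C 1 + (-1 : k) • X j : MvPolynomial ρ k)
      ≤ complexity (C 1 : MvPolynomial ρ k) + complexity ((-1 : k) • X j : MvPolynomial ρ k) + 1 :=
        complexity_add_le_holds _ _
    _ ≤ 0 + (0 + 1) + 1 := by
        gcongr
        · exact (complexity_C_holds (σ := ρ) (1 : k)).le
        · exact (complexity_smul_le_holds _ _).trans (by rw [complexity_X_holds (k := k)])
    _ = 2 := rfl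

/-- **`L(S_n) ≤ 10 (n+1)³`** over any `k` (as `constantFreeComplexity_malodDSummand_le`).
[cite: Burgisser2024Completeness, §4.2 (4.4) (p0016 L8–L11, L53–L61)] -/
theorem complexity_malodDSummand_le : complexity (malodDSummand k n) ≤ 10 * (n + 1) ^ 3 := by
  classical
  have hG : complexity (genericComputation k n) ≤ n * (8 * n + 1) := by
    rw [← circuit_size k n]
    exact ArithCircuit.complexity_le_size (circuit_isFanInTwo k n) (circuit_computes k n)
  have hterm : ∀ kk : Fin (n + 1), complexity (X (Sum.inl (Sum.inr kk)) *
      aeval (boolSpecVar k n kk) (genericComputation k n) *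
        ∏ j ∈ (Finset.univ : Finset (Fin n)).filter (fun j : Fin n => n - kk ≤ j.val),
          (1 - X (Sum.inr j)) : MvPolynomial (DVar n ⊕ Fin n) k) ≤ 9 * (n + 1) ^ 2 := by
    intro kk
    have hA : complexity (aeval (boolSpecVar k n kk) (genericComputation k n)) ≤
        n * (8 * n + 1) := by
      refine (complexity_aeval_le _ _).trans ?_
      simp only [complexity_boolSpecVar, Finset.sum_const_zero, add_zero]
      exact hG
    have hP : complexity (∏ j ∈ (Finset.univ : Finset (Fin n)).filter
        (fun j : Fin n => n - kk ≤ j.val), (1 - X (Sum.inr j)) : MvPolynomial (DVar n ⊕ Fin n) k) ≤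
        3 * n := by
      refine (complexity_finset_prod_le _ _).trans ?_
      have hcard : ((Finset.univ : Finset (Fin n)).filter (fun j : Fin n => n - kk ≤ j.val)).card ≤ n :=
        (Finset.card_filter_le _ _).trans (by simp)
      calc _ ≤ ∑ _j ∈ (Finset.univ : Finset (Fin n)).filter (fun j : Fin n => n - kk ≤ j.val), 2 +
            ((Finset.univ : Finset (Fin n)).filter (fun j : Fin n => n - kk ≤ j.val)).card :=
            Nat.add_le_add_right (Finset.sum_le_sum fun j _ => complexity_one_sub_X_le k _) _
        _ ≤ 3 * n := by rw [Finset.sum_const, smul_eq_mul]; omega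
    calc _ ≤ complexity (X (Sum.inl (Sum.inr kk)) *
          aeval (boolSpecVar k n kk) (genericComputation k n) : MvPolynomial (DVar n ⊕ Fin n) k) +
          complexity (∏ j ∈ (Finset.univ : Finset (Fin n)).filter
            (fun j : Fin n => n - kk ≤ j.val), (1 - X (Sum.inr j)) : MvPolynomial (DVar n ⊕ Fin n) k) + 1 :=
          complexity_mul_le_holds _ _
      _ ≤ (0 + n * (8 * n + 1) + 1) + 3 * n + 1 := by
          gcongr
          · exact (complexity_mul_le_holds _ _).trans (by
              rw [complexity_X_holds (k := k)]
              exact Nat.add_le_add_right (Nat.add_le_add_left hA _) _)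
      _ ≤ 9 * (n + 1) ^ 2 := by nlinarith
  calc complexity (malodDSummand k n)
      ≤ ∑ kk : Fin (n + 1), complexity (X (Sum.inl (Sum.inr kk)) *
          aeval (boolSpecVar k n kk) (genericComputation k n) *
            ∏ j ∈ (Finset.univ : Finset (Fin n)).filter (fun j : Fin n => n - kk ≤ j.val),
              (1 - X (Sum.inr j)) : MvPolynomial (DVar n ⊕ Fin n) k) +
          (Finset.univ : Finset (Fin (n + 1))).card := complexity_finset_sum_le _ _
    _ ≤ ∑ _kk : Fin (n + 1), 9 * (n + 1) ^ 2 + (Finset.univ : Finset (Fin (n + 1))).card :=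
          Nat.add_le_add_right (Finset.sum_le_sum fun kk _ => hterm kk) _
    _ = (n + 1) * (9 * (n + 1) ^ 2) + (n + 1) := by simp
    _ ≤ 10 * (n + 1) ^ 3 := by nlinarith

/-- **The summand family is in `VPnb^k`.** [cite: Burgisser2024Completeness, §4.2 (p0016 L8–L11, L53–L61)] -/
theorem isVPnbFamily_malodDSummand : IsVPnbFamily fun n => malodDSummand k n := by
  have hsucc : IsPBounded fun n => n + 1 := IsPBounded.add_holds IsPBounded.id (IsPBounded.const 1)
  refine (isVPnbFamily_iff_isPComputable _).2
    ⟨(IsPBounded.mul_holds (IsPBounded.const 15) (IsPBounded.pow_holds hsucc 2)).mono fun n => ?_,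
      (IsPBounded.mul_holds (IsPBounded.const 10) (IsPBounded.pow_holds hsucc 3)).mono
        (complexity_malodDSummand_le k)⟩
  simp only [DVar, Var, Fintype.card_sum, Fintype.card_prod, Fintype.card_fin, Fintype.card_bool]
  nlinarith

/-- **`(D_n) ∈ VNPnb^k`** for every commutative ring `k`. [cite: Burgisser2024Completeness, §4.2 (p0016 L8–L11, L55–L61)] -/
theorem isVNPnbFamily_malodD : IsVNPnbFamily fun n => malodD k n :=
  ⟨fun n => n, fun n => malodDSummand k n, isVPnbFamily_malodDSummand k,
    fun n => (boolSum_malodDSummand k n).symm⟩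

end AnyRing

end MalodGeneric

/-! ## The completeness statement -/

/-- **Bürgisser 2024, §4.2 (4.4): "the `VNPnb⁰`-complete sequence `(D_n)`."** Membership
(`MalodGeneric.isVNPnb0Family_malodD`) and hardness: every `VNPnb⁰` family `f` (in any variable
types) is a p-projection of `(D_n)` whose substituted constants are sign constants `0, ±1`:
`f_n = D_{t(n)}(dSpec)` with `t(n) = #σ_n + u(n) + 2|C_n| + 1` for the Boolean-sum length `u` and
the circuits `C_n` witnessing `f ∈ VNPnb⁰`. [cite: Burgisser2024Completeness, §4.2 (4.4) (p0016 L55–L61)] -/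
theorem Bur24_sec4_2_malodD_VNPnb0Complete :
    IsVNPnb0Family (fun n => MalodGeneric.malodD ℤ n) ∧
      ∀ {σ : ℕ → Type v} [∀ n, Fintype (σ n)] (f : ∀ n, MvPolynomial (σ n) ℤ),
        IsVNPnb0Family f →
          ∃ t : ℕ → ℕ, IsPBounded t ∧ ∀ n,
            ∃ φ : MalodGeneric.DVar (t n) → MvPolynomial (σ n) ℤ,
              (∀ i, (∃ x, φ i = X x) ∨ ∃ c : ℤ, ArithCircuit.IsSignConstant c ∧ φ i = C c) ∧
                f n = aeval φ (MalodGeneric.malodD ℤ (t n)) := by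
  refine ⟨MalodGeneric.isVNPnb0Family_malodD, fun {σ} _ f hf => ?_⟩
  obtain ⟨u, g, ⟨hcard, C, hC, hsize⟩, hfg⟩ := hf
  refine ⟨fun n => MalodGeneric.lvl (u n) (C n), ?_, fun n => ?_⟩
  · have h : IsPBounded fun n => Fintype.card (σ n ⊕ Fin (u n)) + 2 * (C n).size + 1 :=
      IsPBounded.add_holds (IsPBounded.add_holds hcard
        (IsPBounded.mul_holds (IsPBounded.const 2) hsize)) (IsPBounded.const 1)
    exact h.mono fun n => (MalodGeneric.lvl_eq (u n) (C n)).le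
  · refine ⟨MalodGeneric.dSpec (u n) (C n),
      MalodGeneric.dSpec_isVarOrSignConst (u n) (C n) (hC n).2.1, ?_⟩
    rw [hfg n, ← (hC n).2.2]
    exact MalodGeneric.boolSum_eval_eq_aeval_dSpec_malodD (u n) (C n) (hC n).1

/-- In particular every `VNPnb⁰` family is a p-projection of `(D_n)` (`IsPProjection`).
[cite: Burgisser2024Completeness, §4.2 (4.4) (p0016 L55–L61)] -/
theorem IsVNPnb0Family.isPProjection_malodD {σ : ℕ → Type v} [∀ n, Fintype (σ n)]
    {f : ∀ n, MvPolynomial (σ n) ℤ} (hf : IsVNPnb0Family f) :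
    IsPProjection f (fun n => MalodGeneric.malodD ℤ n) := by
  obtain ⟨t, ht, h⟩ := Bur24_sec4_2_malodD_VNPnb0Complete.2 f hf
  refine ⟨t, ht, fun n => ?_⟩
  obtain ⟨φ, hφ, hf⟩ := h n
  refine ⟨φ, fun i => ?_, hf⟩
  rcases hφ i with h | ⟨c, -, hc⟩
  · exact Or.inl h
  · exact Or.inr ⟨c, hc⟩

/-- **`(D_n)` is `VNPnb^k`-complete for every commutative ring `k` (constants free)**: membership,
and every `VNPnb^k` family `f` is `f_n = D_{t(n)}(φ_n)`, `t` p-bounded, `φ_n` substituting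
variables of `σ_n` and constants of `k` — the `VNPnb` companion of "these classes are obtained from
the universal classes `VPnb⁰, VNPnb⁰` by specializing certain variables to constants in `𝔽`"
(`Bur24_sec4_2_isVPnbFamily_iff_specialisation`, `IsVNPnbFamily.exists_specialisation`). A
ring-generic form of the printed `ℤ` statement `Bur24_sec4_2_malodD_VNPnb0Complete`.
[cite: Burgisser2024Completeness, §4.2 (4.4) (p0016 L8–L11, L55–L61)] -/
theorem Bur24_sec4_2_malodD_VNPnbComplete (k : Type u) [CommRing k] :
    IsVNPnbFamily (fun n => MalodGeneric.malodD k n) ∧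
      ∀ {σ : ℕ → Type v} [∀ n, Fintype (σ n)] (f : ∀ n, MvPolynomial (σ n) k),
        IsVNPnbFamily f →
          ∃ t : ℕ → ℕ, IsPBounded t ∧ ∀ n,
            ∃ φ : MalodGeneric.DVar (t n) → MvPolynomial (σ n) k,
              (∀ i, (∃ x, φ i = X x) ∨ ∃ c : k, φ i = C c) ∧
                f n = aeval φ (MalodGeneric.malodD k (t n)) := by
  refine ⟨MalodGeneric.isVNPnbFamily_malodD k, fun {σ} _ f hf => ?_⟩
  obtain ⟨u, g, ⟨hcard, C, hC, hsize⟩, hfg⟩ := hf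
  refine ⟨fun n => MalodGeneric.lvl (u n) (C n), ?_, fun n => ?_⟩
  · have h : IsPBounded fun n => Fintype.card (σ n ⊕ Fin (u n)) + 2 * (C n).size + 1 :=
      IsPBounded.add_holds (IsPBounded.add_holds hcard
        (IsPBounded.mul_holds (IsPBounded.const 2) hsize)) (IsPBounded.const 1)
    exact h.mono fun n => (MalodGeneric.lvl_eq (u n) (C n)).le
  · refine ⟨MalodGeneric.dSpec (u n) (C n), MalodGeneric.dSpec_isVarOrConst (u n) (C n), ?_⟩
    rw [hfg n, ← (hC n).2]
    exact MalodGeneric.boolSum_eval_eq_aeval_dSpec_malodD (u n) (C n) (hC n).1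

/-- In particular every `VNPnb^k` family is a p-projection of `(D_n)`.
[cite: Burgisser2024Completeness, §4.2 (4.4) (p0016 L8–L11, L55–L61)] -/
theorem IsVNPnbFamily.isPProjection_malodD {k : Type u} [CommRing k] {σ : ℕ → Type v}
    [∀ n, Fintype (σ n)] {f : ∀ n, MvPolynomial (σ n) k} (hf : IsVNPnbFamily f) :
    IsPProjection f (fun n => MalodGeneric.malodD k n) := by
  obtain ⟨t, ht, h⟩ := (Bur24_sec4_2_malodD_VNPnbComplete k).2 f hf
  exact ⟨t, ht, fun n => h n⟩

end Literature.Computability.AlgebraicComplexity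

end
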